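import Summits.BirchSwinnertonDyer.BirchSwinnertonDyer.Theses.ResidualThetaTransportAtTwo
import Summits.BirchSwinnertonDyer.BirchSwinnertonDyer.Theorems.ResidualThetaTransportAtTwoSignedMuVanishingAtTwoPlusAnalyticChild
import Summits.BirchSwinnertonDyer.BirchSwinnertonDyer.Theorems.ResidualThetaTransportAtTwoSignedMuVanishingAtTwoPlusLine
import Summits.BirchSwinnertonDyer.BirchSwinnertonDyer.Theorems.ResidualThetaTransportAtTwoResidualThetaMainConjectureAtTwoLayerMuReading
import Summits.BirchSwinnertonDyer.BirchSwinnertonDyer.Theorems.ByReductionTypeAtTwoSupersingularSharpTwo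
import Literature.NumberTheory.EllipticCurves.AnalyticRankOrderProofs
import Literature.NumberTheory.EllipticCurves.CuspFormLFunctionAnalyticRankProofs
import HarnessLib

/-!
# Route `ResidualThetaTransportAtTwo`, crux Kμ⁺ `SignedMuVanishingAtTwoPlus` (stmt-BirchSwinnertonDyer-20689),
# line `birth` v3, stub `stub_flatMuZeroAtTwo`: the θ-LAYER READING of the flat residue —
# «`2 ∤ L♭` for every Pollack pair at `2`» ⟺ «ONE even Mazur–Tate layer `θ_n(f)` has a `2`-adic unit coefficient»

Cell `bsd-wall`, width seat `bsd-wall-rtt-p4-w3` (helper for the registered stub `stub_flatMuZeroAtTwo :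
FlatMuZeroAtTwo` of `Cruxes/SignedMuVanishingAtTwoPlus/Lines/birth.lean`; THEOREMS ONLY — no `def`, no named
fact, no `sorry`; nothing about any curve is asserted; BSD is not proved by this).

The stub quantifies over the `2`-adic objects `(L♯, L♭)` (`IsPollackPair f 2 L♯ L♭`, Pollack 2003 Prop. 6.18
congruences at `p = 2`) and asks `2 ∤ L♭` in `Λ = ℤ₂⟦T⟧` (`μ(L♭_f) = 0`). The route's own kernel layer reading
(seat rtt-p2, crux 20787, `ResidualThetaLayer.supNorm_mazurTateElement_two_le` / `…_eq` /
`…mu_eq_zero_of_supNorm_mazurTateElement_two_eq_one`: `μ_n(θ_n(f)) ≥ μ(L⁻)` at every even layer, with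
equality for `n ≥ 2λ(L⁻) + 2`) makes this statement POLLACK-PAIR-FREE and FINITE per layer. This file
records the equivalence in the stub's own currency and the certificates it yields:

* §1 `SignedMuAtTwo.mu_eq_zero_iff_not_C_dvd` — `μ(g) = 0 ⟺ p ∤ g` for `g ≠ 0` (`X1.MuLambda.mu`, any `p`).
* §2 (any weight-2 cusp form `f` on `Γ₀(N)` with a Pollack pair `(L⁺, L⁻)` at `2`):
  `not_two_dvd_flat_of_supNorm_mazurTateElement_eq_one` (one even layer with `max_j |θ_n(f)_j|₂ = 1` ⇒
  `2 ∤ L⁻`), `not_two_dvd_flat_of_one_le_norm_coeff_mazurTateElement` (ONE coefficient of ONE even layer with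
  `|θ_n(f)_j|₂ ≥ 1` suffices — the other coefficients are automatically `2`-integral),
  `supNorm_mazurTateElement_eq_one_of_not_two_dvd_flat` (conversely `2 ∤ L⁻` ⇒ `max_j |θ_n(f)_j|₂ = 1` for
  every even `n ≥ 2λ(L⁻) + 2`), hence `not_two_dvd_flat_iff_exists_supNorm_mazurTateElement_eq_one` and the
  eventual form `not_two_dvd_flat_iff_eventually_supNorm_mazurTateElement_eq_one`; and, because the pair is only
  quantified, `forall_isPollackPair_two_not_two_dvd_iff` (needs one pair to exist).
* §3 (the habitat⁺): `flatAtTwo_iff_exists_supNorm_mazurTateElement_eq_one` — for `W` good supersingular at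
  `2` with `a₂ = 0`, `r_an = 0` and newform `f` (a Pollack pair at `2` EXISTS: Sprung's pair,
  `exists_isPollackPair_two`; `L(W,1) ≠ 0` by `analyticRank_eq_zero_iff_holds`), FLAT-at-`(W,f)` ⟺
  `∃ n even, max_j |θ_n(f)_j|₂ = 1`; `flatMuZeroAtTwo_iff_thetaLayerUnitAtTwo` — the registered stub statement
  `FlatMuZeroAtTwo` (spelled verbatim) ⟺ its θ-layer form «every habitat⁺ newform has an even Mazur–Tate layer
  with a unit coefficient» (a statement about finitely many modular symbols `[a/2^{n+2}]⁺_f` per layer, the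
  ENGINE-2 column `μ(θ_n) = 0` of the cell's tables, instead of the limit object `L♭`);
  `signedMuAnalyticAtTwoPlus_of_periodUnit_of_thetaLayerUnit` / `…_of_abbesUllmo_of_thetaLayerUnit` /
  `signedMuAnalyticAtTwoPlus_iff_thetaLayerUnit_of_abbesUllmo` — the analytic child 21437 from / as the θ-layer
  statement (granted the period unit, resp. Abbes–Ullmo Thm. A by name); and
  `signedMuVanishingAtTwoPlus_of_residualFinite_of_periodUnit_of_thetaLayerUnit` — the crux BY NAME from
  (RESID) ∧ (PER) ∧ (θ-LAYER), i.e. the line's composition with stub 3 in layer currency.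

References: R. Pollack, Duke Math. J. 118 (2003) Prop. 6.18 [Pollack2003]; R. Pollack, T. Weston, Duke Math.
J. 156 (2011) §3.1, §4 [PollackWeston2011MT]; F. Sprung, ANT 11 (2017) Cor. 4.4 [Sprung2017]; A. Abbes,
E. Ullmo, Compositio 103 (1996) Thm. A [AbbesUllmo1996].
-/

set_option autoImplicit false
set_option linter.dupNamespace false

noncomputable section

open scoped Classical MatrixGroups ModularForm

open CongruenceSubgroup Polynomial WeierstrassCurve Literature.NumberTheory.EllipticCurves
  Literature.NumberTheory.EllipticCurves.ModularForms Literature.NumberTheory.EllipticCurves.Rank1Residual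
  Literature.NumberTheory.EllipticCurves.Kobayashi2003 Literature.NumberTheory.EllipticCurves.IwasawaAlgebra
  Summit.BirchSwinnertonDyer.Rank1Residual.Supersingular Summit.BirchSwinnertonDyer.Rank1Residual.X1
  Summit.BirchSwinnertonDyer.BirchSwinnertonDyer.Theses.ResidualThetaTransportAtTwo

namespace Summit.BirchSwinnertonDyer.BirchSwinnertonDyer.Theorems.SignedMuAtTwo

/-! ## §1. `μ(g) = 0 ⟺ p ∤ g` -/

/-- For `g ≠ 0` in `Λ = ℤ_p⟦T⟧`: `μ(g) = 0` (`X1.MuLambda.mu`, the exact power of `p` dividing `g`) iff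
`p ∤ g`. [folklore] -/
theorem mu_eq_zero_iff_not_C_dvd {p : ℕ} [Fact p.Prime] {g : IwasawaAlgebra p} (hg : g ≠ 0) :
    MuLambda.mu g = 0 ↔ ¬ PowerSeries.C (p : ℤ_[p]) ∣ g := by
  constructor
  · intro h hdvd
    have h1 : PowerSeries.C ((p : ℤ_[p]) ^ 1) ∣ g := by rwa [pow_one]
    have h2 := MuLambda.le_mu_of_C_pow_dvd hg h1
    omega
  · intro h
    by_contra hne
    obtain ⟨k, hk⟩ := Nat.exists_eq_succ_of_ne_zero hne
    have hdvd := MuLambda.C_pow_mu_dvd hg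
    rw [hk, pow_succ, map_mul] at hdvd
    exact h ((dvd_mul_left _ _).trans hdvd)

/-! ## §2. One cusp form with a Pollack pair at `2` -/

section Layer

variable {N : ℕ} (f : CuspForm (Gamma0 N) 2) {Lplus Lminus : IwasawaAlgebra 2}

/-- The coefficients of `θ_n(f)` read in `ℚ̄₂` have the `2`-adic norms of the rational numbers they are.
[folklore] -/
theorem norm_coeff_map_mazurTateElement (n j : ℕ) :
    ‖((mazurTateElement f 2 n).map (algebraMap ℚ (PadicAlgCl 2))).coeff j‖ =
      ‖(((mazurTateElement f 2 n).coeff j : ℚ) : ℚ_[2])‖ := by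
  have hφ : algebraMap ℚ (PadicAlgCl 2) = (algebraMap ℚ_[2] (PadicAlgCl 2)).comp (algebraMap ℚ ℚ_[2]) :=
    RingHom.ext_rat _ _
  rw [coeff_map, hφ, RingHom.comp_apply, norm_algebraMap', eq_ratCast]

/-- **One even layer with `μ_n(θ_n(f)) = 0` certifies `2 ∤ L⁻`**: if `max_j |θ_n(f)_j|₂ = 1` for some even
`n`, then `2 ∤ L⁻` for the Pollack pair. [cite: Pollack2003, Prop. 6.18] [cite: PollackWeston2011MT, §3.1] -/
theorem not_two_dvd_flat_of_supNorm_mazurTateElement_eq_one (hP : IsPollackPair f 2 Lplus Lminus) {n : ℕ}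
    (hn : Even n) (h1 : ((mazurTateElement f 2 n).map (algebraMap ℚ (PadicAlgCl 2))).supNorm = 1) :
    ¬ PowerSeries.C (2 : ℤ_[2]) ∣ Lminus := by
  have hμ := ResidualThetaLayer.mu_eq_zero_of_supNorm_mazurTateElement_two_eq_one f hP hn h1
  have h := (mu_eq_zero_iff_not_C_dvd (p := 2) hP.2.1).mp hμ
  simpa using h

/-- **ONE coefficient suffices**: if some coefficient of some even layer `θ_n(f)` has `|θ_n(f)_j|₂ ≥ 1`, then
`2 ∤ L⁻` (all coefficients are `2`-integral anyway: `max_j |θ_n(f)_j|₂ ≤ 2^{−μ(L⁻)} ≤ 1`).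
[cite: Pollack2003, Prop. 6.18] [cite: PollackWeston2011MT, §3.1] -/
theorem not_two_dvd_flat_of_one_le_norm_coeff_mazurTateElement (hP : IsPollackPair f 2 Lplus Lminus)
    {n : ℕ} (hn : Even n) {j : ℕ} (hj : 1 ≤ ‖(((mazurTateElement f 2 n).coeff j : ℚ) : ℚ_[2])‖) :
    ¬ PowerSeries.C (2 : ℤ_[2]) ∣ Lminus := by
  have hle := ResidualThetaLayer.supNorm_mazurTateElement_two_le f hP hn
  have hcoeff := ((mazurTateElement f 2 n).map (algebraMap ℚ (PadicAlgCl 2))).le_supNorm j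
  rw [norm_coeff_map_mazurTateElement] at hcoeff
  have h1 : (1 : ℝ) ≤ (2 : ℝ)⁻¹ ^ MuLambda.mu Lminus := hj.trans (hcoeff.trans hle)
  have hμ : MuLambda.mu Lminus = 0 := by
    by_contra hne
    exact absurd h1 (not_le.mpr (pow_lt_one₀ (by norm_num) (by norm_num) hne))
  have h := (mu_eq_zero_iff_not_C_dvd (p := 2) hP.2.1).mp hμ
  simpa using h

/-- **Conversely, `2 ∤ L⁻` ⇒ `μ_n(θ_n(f)) = 0` at every even layer `n ≥ 2λ(L⁻) + 2.**
[cite: Pollack2003, Prop. 6.18] [cite: PollackWeston2011MT, §3.1 and §4] -/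
theorem supNorm_mazurTateElement_eq_one_of_not_two_dvd_flat (hP : IsPollackPair f 2 Lplus Lminus)
    (hflat : ¬ PowerSeries.C (2 : ℤ_[2]) ∣ Lminus) {n : ℕ} (hn : Even n)
    (hle : 2 * MuLambda.lam Lminus + 2 ≤ n) :
    ((mazurTateElement f 2 n).map (algebraMap ℚ (PadicAlgCl 2))).supNorm = 1 := by
  have hμ : MuLambda.mu Lminus = 0 :=
    (mu_eq_zero_iff_not_C_dvd (p := 2) hP.2.1).mpr (by simpa using hflat)
  rw [ResidualThetaLayer.supNorm_mazurTateElement_two_eq f hP hle hn, hμ, pow_zero]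

/-- **`2 ∤ L⁻` ⟺ some even layer has a unit coefficient.** [cite: Pollack2003, Prop. 6.18]
[cite: PollackWeston2011MT, §3.1 and §4] -/
theorem not_two_dvd_flat_iff_exists_supNorm_mazurTateElement_eq_one (hP : IsPollackPair f 2 Lplus Lminus) :
    ¬ PowerSeries.C (2 : ℤ_[2]) ∣ Lminus ↔
      ∃ n : ℕ, Even n ∧ ((mazurTateElement f 2 n).map (algebraMap ℚ (PadicAlgCl 2))).supNorm = 1 :=
  ⟨fun h ↦ ⟨2 * MuLambda.lam Lminus + 2, ⟨MuLambda.lam Lminus + 1, by ring⟩,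
      supNorm_mazurTateElement_eq_one_of_not_two_dvd_flat f hP h ⟨MuLambda.lam Lminus + 1, by ring⟩ le_rfl⟩,
    fun ⟨_, hn, h1⟩ ↦ not_two_dvd_flat_of_supNorm_mazurTateElement_eq_one f hP hn h1⟩

/-- **`2 ∤ L⁻` ⟺ all large even layers have a unit coefficient.** [cite: Pollack2003, Prop. 6.18]
[cite: PollackWeston2011MT, §3.1 and §4] -/
theorem not_two_dvd_flat_iff_eventually_supNorm_mazurTateElement_eq_one (hP : IsPollackPair f 2 Lplus Lminus) :
    ¬ PowerSeries.C (2 : ℤ_[2]) ∣ Lminus ↔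
      ∃ n₀ : ℕ, ∀ n : ℕ, n₀ ≤ n → Even n →
        ((mazurTateElement f 2 n).map (algebraMap ℚ (PadicAlgCl 2))).supNorm = 1 := by
  refine ⟨fun h ↦ ⟨2 * MuLambda.lam Lminus + 2, fun n hn heven ↦
      supNorm_mazurTateElement_eq_one_of_not_two_dvd_flat f hP h heven hn⟩, fun ⟨n₀, hn₀⟩ ↦ ?_⟩
  rcases Nat.even_or_odd n₀ with h0 | h0
  · exact not_two_dvd_flat_of_supNorm_mazurTateElement_eq_one f hP h0 (hn₀ n₀ le_rfl h0)
  · exact not_two_dvd_flat_of_supNorm_mazurTateElement_eq_one f hP (Odd.add_one h0)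
      (hn₀ (n₀ + 1) (Nat.le_succ _) (Odd.add_one h0))

/-- **In `layerMu` currency** (Pollack–Weston's `μ(θ_n)`): `2 ∤ L⁻` ⟺ some even `θ_n(f) ≠ 0` has
`μ_n(θ_n(f)) = 0`. [cite: PollackWeston2011MT, §3.1] -/
theorem not_two_dvd_flat_iff_exists_layerMu_mazurTateElement_eq_zero (hP : IsPollackPair f 2 Lplus Lminus) :
    ¬ PowerSeries.C (2 : ℤ_[2]) ∣ Lminus ↔
      ∃ n : ℕ, Even n ∧ (mazurTateElement f 2 n).map (algebraMap ℚ (PadicAlgCl 2)) ≠ 0 ∧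
        Literature.NumberTheory.IwasawaTheory.layerMu 2
          ((mazurTateElement f 2 n).map (algebraMap ℚ (PadicAlgCl 2))) = 0 := by
  rw [not_two_dvd_flat_iff_exists_supNorm_mazurTateElement_eq_one f hP]
  constructor
  · rintro ⟨n, hn, h1⟩
    have hne : (mazurTateElement f 2 n).map (algebraMap ℚ (PadicAlgCl 2)) ≠ 0 := by
      intro h0
      rw [h0, supNorm_zero] at h1
      exact zero_ne_one h1
    exact ⟨n, hn, hne, (Literature.NumberTheory.IwasawaTheory.layerMu_eq_zero_iff one_lt_two hne).mpr h1⟩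
  · rintro ⟨n, hn, hne, h0⟩
    exact ⟨n, hn, (Literature.NumberTheory.IwasawaTheory.layerMu_eq_zero_iff one_lt_two hne).mp h0⟩

/-- **With the pair only quantified** (the stub's shape): if SOME Pollack pair at `2` exists for `f`, then
«`2 ∤ L⁻` for EVERY Pollack pair `(L⁺, L⁻)` at `2`» ⟺ «some even layer of `f` has a unit coefficient».
[cite: Pollack2003, Prop. 6.18] [cite: PollackWeston2011MT, §3.1 and §4] -/
theorem forall_isPollackPair_two_not_two_dvd_iff (hex : ∃ Lplus Lminus : IwasawaAlgebra 2, IsPollackPair f 2 Lplus Lminus) :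
    (∀ Lplus Lminus : IwasawaAlgebra 2, IsPollackPair f 2 Lplus Lminus → ¬ PowerSeries.C (2 : ℤ_[2]) ∣ Lminus) ↔
      ∃ n : ℕ, Even n ∧ ((mazurTateElement f 2 n).map (algebraMap ℚ (PadicAlgCl 2))).supNorm = 1 := by
  obtain ⟨Lp, Lm, hP⟩ := hex
  exact ⟨fun h ↦ (not_two_dvd_flat_iff_exists_supNorm_mazurTateElement_eq_one f hP).mp (h Lp Lm hP),
    fun ⟨_, hn, h1⟩ _ _ hP' ↦ not_two_dvd_flat_of_supNorm_mazurTateElement_eq_one f hP' hn h1⟩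

end Layer

/-! ## §3. The habitat⁺: the stub `FlatMuZeroAtTwo` in θ-layer currency -/

section Habitat

variable {W : WeierstrassCurve ℚ} [W.IsElliptic] [W.IsGloballyMinimal]

/-- **FLAT-at-`(W, f)` ⟺ some even Mazur–Tate layer of `f` has a unit coefficient**, for `W` good
supersingular at `2` with `a₂ = 0`, analytic rank `0`, and `f` its newform: a Pollack pair at `2` exists
(Sprung's pair, `exists_isPollackPair_two`; `L(W,1) ≠ 0` from `r_an = 0` by `analyticRank_eq_zero_iff_holds`
with the entire continuation supplied by `f`). [cite: Sprung2017, Cor. 4.4] [cite: Pollack2003, Prop. 6.18]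
[cite: PollackWeston2011MT, §3.1 and §4] -/
theorem flatAtTwo_iff_exists_supNorm_mazurTateElement_eq_one [NeZero (W.conductorNorm ℤ)]
    {f : CuspForm (Gamma0 (W.conductorNorm ℤ)) 2} (hf : IsNewformOf W f) (hss : GoodSS W 2)
    (ha : W.frobeniusTrace 2 = 0) (hr : W.analyticRank = 0) :
    (∀ Lplus Lminus : IwasawaAlgebra 2, IsPollackPair f 2 Lplus Lminus → ¬ PowerSeries.C (2 : ℤ_[2]) ∣ Lminus) ↔
      ∃ n : ℕ, Even n ∧ ((mazurTateElement f 2 n).map (algebraMap ℚ (PadicAlgCl 2))).supNorm = 1 := by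
  have hL : W.entireLFunction 1 ≠ 0 :=
    (WeierstrassCurve.analyticRank_eq_zero_iff_holds (W := W) hf.hasEntireLFunction).mp hr
  obtain ⟨Ls, Lf, -, hP⟩ := exists_isPollackPair_two hf hss.1 ha hL
  exact forall_isPollackPair_two_not_two_dvd_iff f ⟨Ls, Lf, hP⟩

/-- **Per-class certificate, layer form**: on the habitat, ONE coefficient of ONE even Mazur–Tate layer of the
newform with `|θ_n(f)_j|₂ ≥ 1` gives FLAT-at-`(W, f)` (for every Pollack pair at `2`). Generalises the
constant-term certificate `not_two_dvd_flat_of_norm_ratPlusSymbol_zero_eq_one` (`n = 0`: `θ₀ = 2[1/4]⁺_f = −[0]⁺_f`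
at `a₂ = 0`). [cite: Pollack2003, Prop. 6.18] [cite: PollackWeston2011MT, §3.1] -/
theorem flatAtTwo_of_one_le_norm_coeff_mazurTateElement {N : ℕ} {f : CuspForm (Gamma0 N) 2} {n : ℕ}
    (hn : Even n) {j : ℕ} (hj : 1 ≤ ‖(((mazurTateElement f 2 n).coeff j : ℚ) : ℚ_[2])‖) :
    ∀ Lplus Lminus : IwasawaAlgebra 2, IsPollackPair f 2 Lplus Lminus → ¬ PowerSeries.C (2 : ℤ_[2]) ∣ Lminus :=
  fun _ _ hP ↦ not_two_dvd_flat_of_one_le_norm_coeff_mazurTateElement f hP hn hj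

/-- **The registered stub `FlatMuZeroAtTwo` ⟺ its θ-layer form** `ThetaLayerUnitAtTwo`: «for every habitat⁺
curve `W` and its newform `f`, some even Mazur–Tate layer `θ_n(f)` has `max_j |θ_n(f)_j|₂ = 1`» — a statement
about the finitely many modular symbols `[a/2^{n+2}]⁺_f` of one layer per curve, with no `2`-adic `L`-function
in it. (Both sides spelled verbatim; the left side is the body of `Cruxes/…/Lines/birth.lean`'s `FlatMuZeroAtTwo`.)
[cite: Pollack2003, Prop. 6.18] [cite: PollackWeston2011MT, §3.1 and §4] [cite: Sprung2017, Cor. 4.4] -/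
theorem flatMuZeroAtTwo_iff_thetaLayerUnitAtTwo :
    (∀ (W : WeierstrassCurve ℚ) [W.IsElliptic] [W.IsGloballyMinimal], ¬ W.HasCM → W.analyticRank = 0 →
      GoodSS W 2 → W.frobeniusTrace 2 = 0 → W.Δ < 0 →
      ∀ [NeZero (W.conductorNorm ℤ)] (f : CuspForm (Gamma0 (W.conductorNorm ℤ)) 2), IsNewformOf W f →
      ∀ (Lplus Lminus : IwasawaAlgebra 2), IsPollackPair f 2 Lplus Lminus →
      ¬ PowerSeries.C (2 : ℤ_[2]) ∣ Lminus) ↔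
    (∀ (W : WeierstrassCurve ℚ) [W.IsElliptic] [W.IsGloballyMinimal], ¬ W.HasCM → W.analyticRank = 0 →
      GoodSS W 2 → W.frobeniusTrace 2 = 0 → W.Δ < 0 →
      ∀ [NeZero (W.conductorNorm ℤ)] (f : CuspForm (Gamma0 (W.conductorNorm ℤ)) 2), IsNewformOf W f →
      ∃ n : ℕ, Even n ∧ ((mazurTateElement f 2 n).map (algebraMap ℚ (PadicAlgCl 2))).supNorm = 1) := by
  constructor
  · intro h W _ _ hCM hr hss ha hΔ _ f hf
    exact (flatAtTwo_iff_exists_supNorm_mazurTateElement_eq_one hf hss ha hr).mp (h W hCM hr hss ha hΔ f hf)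
  · intro h W _ _ hCM hr hss ha hΔ _ f hf
    exact (flatAtTwo_iff_exists_supNorm_mazurTateElement_eq_one hf hss ha hr).mpr (h W hCM hr hss ha hΔ f hf)

/-- **(PER) ∧ (θ-LAYER) ⇒ the analytic child 21437 `SignedMuAnalyticAtTwoPlus`** (by name).
[cite: Pollack2003, Prop. 6.18] [cite: GreenbergVatsal2000, §3, Remark 3.4] [cite: PollackWeston2011MT, §3.1] -/
theorem signedMuAnalyticAtTwoPlus_of_periodUnit_of_thetaLayerUnit
    (hper : ∀ (W : WeierstrassCurve ℚ) [W.IsElliptic] [W.IsGloballyMinimal], GoodSS W 2 →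
      ∀ [NeZero (W.conductorNorm ℤ)] (f : CuspForm (Gamma0 (W.conductorNorm ℤ)) 2), IsNewformOf W f →
      ∃ u : ℚ, ‖(u : ℚ_[2])‖ = 1 ∧ W.realPeriodRat = u * plusPeriod f)
    (hθ : ∀ (W : WeierstrassCurve ℚ) [W.IsElliptic] [W.IsGloballyMinimal], ¬ W.HasCM → W.analyticRank = 0 →
      GoodSS W 2 → W.frobeniusTrace 2 = 0 → W.Δ < 0 →
      ∀ [NeZero (W.conductorNorm ℤ)] (f : CuspForm (Gamma0 (W.conductorNorm ℤ)) 2), IsNewformOf W f →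
      ∃ n : ℕ, Even n ∧ ((mazurTateElement f 2 n).map (algebraMap ℚ (PadicAlgCl 2))).supNorm = 1) :
    SignedMuAnalyticAtTwoPlus :=
  signedMuAnalyticAtTwoPlus_of_periodUnit_of_flatMuZero hper (flatMuZeroAtTwo_iff_thetaLayerUnitAtTwo.mpr hθ)

/-- **GRANTED Abbes–Ullmo Thm. A (by name), (θ-LAYER) ⇒ the analytic child 21437.**
[cite: AbbesUllmo1996, Thm. A] [cite: Pollack2003, Prop. 6.18] [cite: PollackWeston2011MT, §3.1] -/
theorem signedMuAnalyticAtTwoPlus_of_abbesUllmo_of_thetaLayerUnit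
    (hAU : abbesUllmo_not_dvd_maninConstant_of_not_dvd_level)
    (hθ : ∀ (W : WeierstrassCurve ℚ) [W.IsElliptic] [W.IsGloballyMinimal], ¬ W.HasCM → W.analyticRank = 0 →
      GoodSS W 2 → W.frobeniusTrace 2 = 0 → W.Δ < 0 →
      ∀ [NeZero (W.conductorNorm ℤ)] (f : CuspForm (Gamma0 (W.conductorNorm ℤ)) 2), IsNewformOf W f →
      ∃ n : ℕ, Even n ∧ ((mazurTateElement f 2 n).map (algebraMap ℚ (PadicAlgCl 2))).supNorm = 1) :
    SignedMuAnalyticAtTwoPlus :=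
  signedMuAnalyticAtTwoPlus_of_abbesUllmo_of_flatMuZero hAU (flatMuZeroAtTwo_iff_thetaLayerUnitAtTwo.mpr hθ)

/-- **GRANTED Abbes–Ullmo, the analytic child 21437 IS the θ-layer statement** (every habitat⁺ newform has an
even Mazur–Tate layer with a unit coefficient). [cite: AbbesUllmo1996, Thm. A] [cite: Pollack2003, Prop. 6.18]
[cite: PollackWeston2011MT, §3.1 and §4] -/
theorem signedMuAnalyticAtTwoPlus_iff_thetaLayerUnit_of_abbesUllmo
    (hAU : abbesUllmo_not_dvd_maninConstant_of_not_dvd_level) :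
    SignedMuAnalyticAtTwoPlus ↔
      ∀ (W : WeierstrassCurve ℚ) [W.IsElliptic] [W.IsGloballyMinimal], ¬ W.HasCM → W.analyticRank = 0 →
        GoodSS W 2 → W.frobeniusTrace 2 = 0 → W.Δ < 0 →
        ∀ [NeZero (W.conductorNorm ℤ)] (f : CuspForm (Gamma0 (W.conductorNorm ℤ)) 2), IsNewformOf W f →
        ∃ n : ℕ, Even n ∧ ((mazurTateElement f 2 n).map (algebraMap ℚ (PadicAlgCl 2))).supNorm = 1 := by
  rw [signedMuAnalyticAtTwoPlus_iff_flatMuZero_of_abbesUllmo hAU, flatMuZeroAtTwo_iff_thetaLayerUnitAtTwo]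

/-- **(RESID) ∧ (PER) ∧ (θ-LAYER) ⇒ the crux `SignedMuVanishingAtTwoPlus` BY NAME** — the line `birth` v3
composition with stub 3 in θ-layer currency (landed `signedMuVanishingAtTwoPlus_of_residualFinite_of_periodUnit_of_flatMuZero`).
[cite: Pollack2003, Prop. 6.18] [cite: PollackWeston2011MT, §3.1 and §4] [cite: GreenbergVatsal2000, Thm. (1.4)] -/
theorem signedMuVanishingAtTwoPlus_of_residualFinite_of_periodUnit_of_thetaLayerUnit
    (hres : ∀ (W : WeierstrassCurve ℚ) [W.IsElliptic] [W.IsGloballyMinimal], ¬ W.HasCM → W.analyticRank = 0 →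
      GoodSS W 2 → W.frobeniusTrace 2 = 0 → W.Δ < 0 →
      ∀ (κ : ZpExtension ℚ 2) (γ : Field.absoluteGaloisGroup ℚ), κ.IsCyclotomic → κ.IsTopGenerator γ →
      ∀ (D : SignedSelmerDualData W κ γ 1) [Module.Finite (IwasawaAlgebra 2) D.X],
        Finite (D.X ⧸ (augIdealP 2 • ⊤ : Submodule (IwasawaAlgebra 2) D.X)))
    (hper : ∀ (W : WeierstrassCurve ℚ) [W.IsElliptic] [W.IsGloballyMinimal], GoodSS W 2 →
      ∀ [NeZero (W.conductorNorm ℤ)] (f : CuspForm (Gamma0 (W.conductorNorm ℤ)) 2), IsNewformOf W f →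
      ∃ u : ℚ, ‖(u : ℚ_[2])‖ = 1 ∧ W.realPeriodRat = u * plusPeriod f)
    (hθ : ∀ (W : WeierstrassCurve ℚ) [W.IsElliptic] [W.IsGloballyMinimal], ¬ W.HasCM → W.analyticRank = 0 →
      GoodSS W 2 → W.frobeniusTrace 2 = 0 → W.Δ < 0 →
      ∀ [NeZero (W.conductorNorm ℤ)] (f : CuspForm (Gamma0 (W.conductorNorm ℤ)) 2), IsNewformOf W f →
      ∃ n : ℕ, Even n ∧ ((mazurTateElement f 2 n).map (algebraMap ℚ (PadicAlgCl 2))).supNorm = 1) :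
    SignedMuVanishingAtTwoPlus :=
  signedMuVanishingAtTwoPlus_of_residualFinite_of_periodUnit_of_flatMuZero hres hper
    (flatMuZeroAtTwo_iff_thetaLayerUnitAtTwo.mpr hθ)

end Habitat

end Summit.BirchSwinnertonDyer.BirchSwinnertonDyer.Theorems.SignedMuAtTwo

end
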